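import Summits.QuantumFields.BalabanUV.Gaps.D1PinnedColourRayQuartic
import Summits.QuantumFields.BalabanUV.Gaps.D1PinnedColourLineTables
import Summits.QuantumFields.BalabanUV.Gaps.D1PinnedFirstOrderPath3

/-!
# D1 (pinned family) — an2's tower along an AFFINE LINE of colour triples obeys the five-node law with ALL moments `k = 0…4`

Census row 79 (item (v), file 3 of 4); the affine-line twin of `D1PinnedColourRayQuartic` (rays through the colour-free member need no first moment; general lines do).  CONTENT (all
[folklore]; 0 def, 0 sorry): §1 `sandwich_poly4`; §2 **`K3OfK_source_decomp₃`** (one level over the affine-quadratic pair path: `K3OfK K N x(t) (W2SymOfK K N x(t) T M₂) =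
−[t⁴X₄ + t³X₃ + t²X₂ + tX₁ + X₀] − K∘W♭∘K − K∘vsym(T)∘K − ½[t⁴K∘E₄∘K + … + K∘E₀∘K]`), **`K3OfK_line_nodes`** (if the bi-stencil slot carries `Σ wᵢ•Tᵢ` with `Σ wᵢ sᵢ^k = t^k`, `k = 0…4`,
so does the source; `set_option maxHeartbeats 1600000` — the statement is whnf-heavy, the proof is `rw` + `linear_combination`); §3′ **`T2Of_line_nodes`** (`T2Of(c⃗₀ + t·c⃗₁) j =
Σᵢ wᵢ • T2Of(c⃗₀ + sᵢ·c⃗₁) j`, generic certified border ∕ mixed tables, any `cE₂ cB T`, every level), **`WbalOf_line_nodes`** (the assembled second-order family likewise).  Imports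
`D1PinnedColourRayQuartic` (p381103), `D1PinnedColourLineTables`, `D1PinnedFirstOrderPath3`.

Provenance: cell pub-balaban-gaps, seat g1-p1 GEN 12 (prover-pub-balaban-gaps-g1-p1-g12-0), 2026-08-24.  HONEST FRAMING: [folklore] kernel algebra BY NAME over tree theorems;
NOTHING of Bałaban's asserted ([Balaban1987RG1] Thm 2 is UNPROVED IN PRINT); NO coefficient computed or signed; binder (D1) of B12 Thm 2 at the β-lead's pinned literal is NOT
discharged; NOT `BetaPertH`, NOT continuum, NOT Clay.
-/

noncomputable section

open Finset
open scoped BigOperators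
open Literature.MathematicalPhysics.QuantumFieldTheory Balaban1983to89 Balaban1983to89.Beta
open ExpKernelCalculus (MKer Decays BiLoc VertexFamily VertexFamily₂ comp)
open OneStepResolventKernel (Fib LocStencil biLoc_mono decays_mono)
open OneStepKernelFamily (KInvStep decays_KInvStep)
open SecondOrderResponse (dM K2OfK W2SymOfK W2OfK LocStencilFM)
open BalabanCompositeJets (LocStencil₂)
open BalabanStepJetsSucc (mmRead e3Of)
open BalabanStepW2 (Spure M1 M2Of WbalOf T2Of T2Of_zero T2Of_succ T2Of_loc e4OfW K3OfK wV4 wB2 locStencilFM_M2Of)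
open StepJetData (mfNeg)
open WilsonBiStencil (wilsonW₂)
open Summit.QuantumFields.BalabanUV.Beta.TameKernelCalculus (Spr Loc)
open Summit.QuantumFields.BalabanUV.Beta.GAN24.T2RecursionAffine (vsym W2SymOfK_eq_add_vsym)
open Summit.QuantumFields.BalabanUV.Beta.GAN24.Lin4Additive (vsym_add vsym_smul)
open Summit.QuantumFields.BalabanUV.Beta.GAN24.WSlotT2OfPieces (locStencil₂_zero)
open Summit.QuantumFields.BalabanUV.Beta.GAN24.ThirdJetKernel (mmRead_smul)
open Summit.QuantumFields.BalabanUV.Beta.VertexReflectionContact (mmRead_add)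
open Summit.QuantumFields.BalabanUV.Beta.BubbleParity (spr_of_decays)
open Summit.QuantumFields.BalabanUV.Gaps.D1PinnedFirstOrderBilinear (sandwich_add loc_dM_of_certs decays_K2OfK_of_certs)
open Summit.QuantumFields.BalabanUV.Gaps.D1PinnedColourRayQuartic (sandwich_wsum5 vsym_wsum5 loc_vsym loc_W2Sym_zero common_bound₂)
open Summit.QuantumFields.BalabanUV.Gaps.D1PinnedFirstOrderPath3 (K3OfK_pure_path₃ W2SymOfK_path₃)
open Summit.QuantumFields.BalabanUV.Gaps.D1PinnedColourLineTables (Spure_line M1_line)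

namespace Summit.QuantumFields.BalabanUV.Gaps.D1PinnedColourLineQuartic

variable {d : ℕ} {N : ℕ} [NeZero N]

omit [NeZero N] in
/-- [folklore] The sandwich of a degree-4 polynomial of localised kernels (`sandwich_add` ×4, `comp_smul_*`). -/
theorem sandwich_poly4 {K X₄ X₃ X₂ X₁ X₀ : MKer (d + 1) (Fib d)} (hKs : Spr K) (h₄ : Loc X₄) (h₃ : Loc X₃) (h₂ : Loc X₂) (h₁ : Loc X₁) (h₀ : Loc X₀) (s : ℝ) :
    comp (comp K (s ^ 4 • X₄ + s ^ 3 • X₃ + s ^ 2 • X₂ + s • X₁ + X₀)) K =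
      s ^ 4 • comp (comp K X₄) K + s ^ 3 • comp (comp K X₃) K + s ^ 2 • comp (comp K X₂) K + s • comp (comp K X₁) K + comp (comp K X₀) K := by
  rw [sandwich_add hKs ((((h₄.smul _).add (h₃.smul _)).add (h₂.smul _)).add (h₁.smul _)) h₀, sandwich_add hKs (((h₄.smul _).add (h₃.smul _)).add (h₂.smul _)) (h₁.smul _),
    sandwich_add hKs ((h₄.smul _).add (h₃.smul _)) (h₂.smul _), sandwich_add hKs (h₄.smul _) (h₃.smul _)]
  simp only [KernelReflection.comp_smul_right, KernelReflection.comp_smul_left]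

/-! ## §2′ One level along an affine-quadratic pair path: the source decomposition and the five-node identity with ALL moments -/

section OneLevel

variable {K : MKer (d + 1) (Fib d)} {A B C P Q R : Fin (d + 1) → (Fin (d + 1) → ℤ) → MKer (d + 1) (Fib d)}
  {M₂ : Fin (d + 1) → (Fin (d + 1) → ℤ) → Fin (d + 1) → (Fin (d + 1) → ℤ) → MKer (d + 1) (Fib d)}

/-- [folklore] **THE SOURCE ALONG AN AFFINE-QUADRATIC PAIR PATH, DECOMPOSED BY DEGREE** (`x(s) = (s²A + sB + C, s²P + sQ + R)`; generic certified data):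
`K3OfK K N x(s) (W2SymOfK K N x(s) T M₂) b b′ = −[s⁴X₄ + s³X₃ + s²X₂ + sX₁ + X₀] − K∘W♭∘K − K∘vsym(T)∘K − ½[s⁴K∘E₄∘K + … + K∘E₀∘K]`. -/
theorem K3OfK_source_decomp₃ (hK : ∃ δ C' : ℝ, 0 < δ ∧ 0 ≤ C' ∧ Decays K C' δ) (hA : ∃ C δ : ℝ, 0 < δ ∧ LocStencil A C δ) (hB : ∃ C δ : ℝ, 0 < δ ∧ LocStencil B C δ)
    (hC : ∃ C' δ : ℝ, 0 < δ ∧ LocStencil C C' δ) (hP : ∃ C δ : ℝ, 0 < δ ∧ VertexFamily P N C δ) (hQ : ∃ C δ : ℝ, 0 < δ ∧ VertexFamily Q N C δ)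
    (hR : ∃ C δ : ℝ, 0 < δ ∧ VertexFamily R N C δ) (hM₂ : ∃ C δ : ℝ, 0 < δ ∧ LocStencilFM N M₂ C δ)
    (T : Fin (d + 1) → (Fin (d + 1) → ℤ) → Fin (d + 1) → (Fin (d + 1) → ℤ) → MKer (d + 1) (Fib d)) (hT : ∃ C δ : ℝ, 0 < δ ∧ LocStencil₂ T C δ)
    (s : ℝ) (μ : Fin (d + 1)) (y : Fin (d + 1) → ℤ) (ν : Fin (d + 1)) (y' : Fin (d + 1) → ℤ) :
    K3OfK K N (fun κ u => s ^ 2 • A κ u + s • B κ u + C κ u) (fun ρ w => s ^ 2 • P ρ w + s • Q ρ w + R ρ w)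
          (W2SymOfK K N (fun κ u => s ^ 2 • A κ u + s • B κ u + C κ u) (fun ρ w => s ^ 2 • P ρ w + s • Q ρ w + R ρ w) T M₂) μ y ν y' =
      -(s ^ 4 • (comp (comp K (dM K N A P μ y)) (K2OfK K N A P ν y') +
            comp (comp K (dM K N A P ν y')) (K2OfK K N A P μ y)) +
        s ^ 3 • (comp (comp K (dM K N A P μ y)) (K2OfK K N B Q ν y') +
            comp (comp K (dM K N A P ν y')) (K2OfK K N B Q μ y) +
            comp (comp K (dM K N B Q μ y)) (K2OfK K N A P ν y') +
            comp (comp K (dM K N B Q ν y')) (K2OfK K N A P μ y)) +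
        s ^ 2 • (comp (comp K (dM K N A P μ y)) (K2OfK K N C R ν y') +
            comp (comp K (dM K N A P ν y')) (K2OfK K N C R μ y) +
            comp (comp K (dM K N B Q μ y)) (K2OfK K N B Q ν y') +
            comp (comp K (dM K N B Q ν y')) (K2OfK K N B Q μ y) +
            comp (comp K (dM K N C R μ y)) (K2OfK K N A P ν y') +
            comp (comp K (dM K N C R ν y')) (K2OfK K N A P μ y)) +
        s • (comp (comp K (dM K N B Q μ y)) (K2OfK K N C R ν y') +
            comp (comp K (dM K N B Q ν y')) (K2OfK K N C R μ y) +
            comp (comp K (dM K N C R μ y)) (K2OfK K N B Q ν y') +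
            comp (comp K (dM K N C R ν y')) (K2OfK K N B Q μ y)) +
        (comp (comp K (dM K N C R μ y)) (K2OfK K N C R ν y') +
            comp (comp K (dM K N C R ν y')) (K2OfK K N C R μ y)))
      - comp (comp K (W2SymOfK K N (fun (_ : Fin (d + 1)) (_ : Fin (d + 1) → ℤ) => (0 : MKer (d + 1) (Fib d))) (fun _ _ => 0) 0 M₂ μ y ν y')) K
      - comp (comp K (vsym K N T μ y ν y')) K
      - (1 / 2 : ℝ) • (s ^ 4 • comp (comp K (dM (K2OfK K N A P ν y') N A P μ y +
            dM (K2OfK K N A P μ y) N A P ν y')) K + s ^ 3 • comp (comp K (dM (K2OfK K N A P ν y') N B Q μ y +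
            dM (K2OfK K N A P μ y) N B Q ν y' +
            dM (K2OfK K N B Q ν y') N A P μ y +
            dM (K2OfK K N B Q μ y) N A P ν y')) K + s ^ 2 • comp (comp K (dM (K2OfK K N A P ν y') N C R μ y +
            dM (K2OfK K N A P μ y) N C R ν y' +
            dM (K2OfK K N B Q ν y') N B Q μ y +
            dM (K2OfK K N B Q μ y) N B Q ν y' +
            dM (K2OfK K N C R ν y') N A P μ y +
            dM (K2OfK K N C R μ y) N A P ν y')) K +
          s • comp (comp K (dM (K2OfK K N B Q ν y') N C R μ y +
            dM (K2OfK K N B Q μ y) N C R ν y' +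
            dM (K2OfK K N C R ν y') N B Q μ y +
            dM (K2OfK K N C R μ y) N B Q ν y')) K + comp (comp K (dM (K2OfK K N C R ν y') N C R μ y +
            dM (K2OfK K N C R μ y) N C R ν y')) K) := by
  have hKs : Spr K := spr_of_decays hK
  have hp := K3OfK_pure_path₃ hK hA hB hC hP hQ hR (W2SymOfK K N (fun κ u => s ^ 2 • A κ u + s • B κ u + C κ u) (fun ρ w => s ^ 2 • P ρ w + s • Q ρ w + R ρ w) T M₂) s μ y ν y'
  have e := congrArg (fun F => F μ y ν y') (W2SymOfK_eq_add_vsym K N (fun (_ : Fin (d + 1)) (_ : Fin (d + 1) → ℤ) => (0 : MKer (d + 1) (Fib d))) (fun _ _ => 0) T M₂)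
  simp only [Pi.add_apply] at e
  have l0 : Loc (W2SymOfK K N (fun (_ : Fin (d + 1)) (_ : Fin (d + 1) → ℤ) => (0 : MKer (d + 1) (Fib d))) (fun _ _ => 0) 0 M₂ μ y ν y') :=
    loc_W2Sym_zero hK hM₂ 0 ⟨0, 1, one_pos, locStencil₂_zero 1⟩ μ y ν y'
  have lv : Loc (vsym K N T μ y ν y') := loc_vsym hK T hT μ y ν y'
  have lD : ∀ {a₁ a₂ : Fin (d + 1) → (Fin (d + 1) → ℤ) → MKer (d + 1) (Fib d)} {p₁ p₂ : Fin (d + 1) → (Fin (d + 1) → ℤ) → MKer (d + 1) (Fib d)},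
      (∃ C δ : ℝ, 0 < δ ∧ LocStencil a₁ C δ) → (∃ C δ : ℝ, 0 < δ ∧ VertexFamily p₁ N C δ) → (∃ C δ : ℝ, 0 < δ ∧ LocStencil a₂ C δ) → (∃ C δ : ℝ, 0 < δ ∧ VertexFamily p₂ N C δ) →
      ∀ c z c' z', Loc (dM (K2OfK K N a₁ p₁ c' z') N a₂ p₂ c z) := fun h₁ q₁ h₂ q₂ c z c' z' => loc_dM_of_certs (decays_K2OfK_of_certs hK h₁ q₁ c' z') h₂ q₂ c z
  have l4 : Loc (dM (K2OfK K N A P ν y') N A P μ y +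
            dM (K2OfK K N A P μ y) N A P ν y') := ((lD hA hP hA hP μ y ν y').add (lD hA hP hA hP ν y' μ y))
  have l3 : Loc (dM (K2OfK K N A P ν y') N B Q μ y +
            dM (K2OfK K N A P μ y) N B Q ν y' +
            dM (K2OfK K N B Q ν y') N A P μ y +
            dM (K2OfK K N B Q μ y) N A P ν y') := ((((lD hA hP hB hQ μ y ν y').add (lD hA hP hB hQ ν y' μ y)).add (lD hB hQ hA hP μ y ν y')).add (lD hB hQ hA hP ν y' μ y))
  have l2 : Loc (dM (K2OfK K N A P ν y') N C R μ y +
            dM (K2OfK K N A P μ y) N C R ν y' +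
            dM (K2OfK K N B Q ν y') N B Q μ y +
            dM (K2OfK K N B Q μ y) N B Q ν y' +
            dM (K2OfK K N C R ν y') N A P μ y +
            dM (K2OfK K N C R μ y) N A P ν y') := ((((((lD hA hP hC hR μ y ν y').add (lD hA hP hC hR ν y' μ y)).add (lD hB hQ hB hQ μ y ν y')).add (lD hB hQ hB hQ ν y' μ y)).add (lD hC hR hA hP μ y ν y')).add (lD hC hR hA hP ν y' μ y))
  have l1 : Loc (dM (K2OfK K N B Q ν y') N C R μ y +
            dM (K2OfK K N B Q μ y) N C R ν y' +
            dM (K2OfK K N C R ν y') N B Q μ y +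
            dM (K2OfK K N C R μ y) N B Q ν y') := ((((lD hB hQ hC hR μ y ν y').add (lD hB hQ hC hR ν y' μ y)).add (lD hC hR hB hQ μ y ν y')).add (lD hC hR hB hQ ν y' μ y))
  have l0' : Loc (dM (K2OfK K N C R ν y') N C R μ y +
            dM (K2OfK K N C R μ y) N C R ν y') := ((lD hC hR hC hR μ y ν y').add (lD hC hR hC hR ν y' μ y))
  have lE := (((((l4.smul (s ^ 4)).add (l3.smul (s ^ 3))).add (l2.smul (s ^ 2))).add (l1.smul s)).add l0').smul (1 / 2 : ℝ)
  rw [eq_sub_of_add_eq hp, W2SymOfK_path₃ hK hA hB hC hP hQ hR T M₂ s μ y ν y', e, sandwich_add hKs (l0.add lv) lE, sandwich_add hKs l0 lv, KernelReflection.comp_smul_right,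
    KernelReflection.comp_smul_left, sandwich_poly4 hKs l4 l3 l2 l1 l0' s]
  abel

set_option maxHeartbeats 1600000 in
/-- [folklore] **THE FIVE-NODE IDENTITY AT ONE LEVEL ALONG AN AFFINE-QUADRATIC PATH — ALL MOMENTS `k = 0,…,4`** (generic certified data). -/
theorem K3OfK_line_nodes (hK : ∃ δ C' : ℝ, 0 < δ ∧ 0 ≤ C' ∧ Decays K C' δ) (hA : ∃ C δ : ℝ, 0 < δ ∧ LocStencil A C δ) (hB : ∃ C δ : ℝ, 0 < δ ∧ LocStencil B C δ)
    (hC : ∃ C' δ : ℝ, 0 < δ ∧ LocStencil C C' δ) (hP : ∃ C δ : ℝ, 0 < δ ∧ VertexFamily P N C δ) (hQ : ∃ C δ : ℝ, 0 < δ ∧ VertexFamily Q N C δ)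
    (hR : ∃ C δ : ℝ, 0 < δ ∧ VertexFamily R N C δ) (hM₂ : ∃ C δ : ℝ, 0 < δ ∧ LocStencilFM N M₂ C δ)
    {T₀ T₁ T₂ T₃ T₄ Tt : Fin (d + 1) → (Fin (d + 1) → ℤ) → Fin (d + 1) → (Fin (d + 1) → ℤ) → MKer (d + 1) (Fib d)}
    (hT₀ : ∃ C δ : ℝ, 0 < δ ∧ LocStencil₂ T₀ C δ) (hT₁ : ∃ C δ : ℝ, 0 < δ ∧ LocStencil₂ T₁ C δ) (hT₂ : ∃ C δ : ℝ, 0 < δ ∧ LocStencil₂ T₂ C δ) (hT₃ : ∃ C δ : ℝ, 0 < δ ∧ LocStencil₂ T₃ C δ)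
    (hT₄ : ∃ C δ : ℝ, 0 < δ ∧ LocStencil₂ T₄ C δ) (hTt : ∃ C δ : ℝ, 0 < δ ∧ LocStencil₂ Tt C δ) (t s₀ s₁ s₂ s₃ s₄ w₀ w₁ w₂ w₃ w₄ : ℝ) (hm0 : w₀ + w₁ + w₂ + w₃ + w₄ = 1)
    (hm1 : w₀ * s₀ + w₁ * s₁ + w₂ * s₂ + w₃ * s₃ + w₄ * s₄ = t)
    (hm2 : w₀ * s₀ ^ 2 + w₁ * s₁ ^ 2 + w₂ * s₂ ^ 2 + w₃ * s₃ ^ 2 + w₄ * s₄ ^ 2 = t ^ 2) (hm3 : w₀ * s₀ ^ 3 + w₁ * s₁ ^ 3 + w₂ * s₂ ^ 3 + w₃ * s₃ ^ 3 + w₄ * s₄ ^ 3 = t ^ 3)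
    (hm4 : w₀ * s₀ ^ 4 + w₁ * s₁ ^ 4 + w₂ * s₂ ^ 4 + w₃ * s₃ ^ 4 + w₄ * s₄ ^ 4 = t ^ 4) (hsum : Tt = w₀ • T₀ + w₁ • T₁ + w₂ • T₂ + w₃ • T₃ + w₄ • T₄)
    (μ : Fin (d + 1)) (y : Fin (d + 1) → ℤ) (ν : Fin (d + 1)) (y' : Fin (d + 1) → ℤ) :
    K3OfK K N (fun κ u => t ^ 2 • A κ u + t • B κ u + C κ u) (fun ρ w => t ^ 2 • P ρ w + t • Q ρ w + R ρ w)
          (W2SymOfK K N (fun κ u => t ^ 2 • A κ u + t • B κ u + C κ u) (fun ρ w => t ^ 2 • P ρ w + t • Q ρ w + R ρ w) Tt M₂) μ y ν y' =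
      w₀ • K3OfK K N (fun κ u => s₀ ^ 2 • A κ u + s₀ • B κ u + C κ u) (fun ρ w => s₀ ^ 2 • P ρ w + s₀ • Q ρ w + R ρ w)
          (W2SymOfK K N (fun κ u => s₀ ^ 2 • A κ u + s₀ • B κ u + C κ u) (fun ρ w => s₀ ^ 2 • P ρ w + s₀ • Q ρ w + R ρ w) T₀ M₂) μ y ν y' +
      w₁ • K3OfK K N (fun κ u => s₁ ^ 2 • A κ u + s₁ • B κ u + C κ u) (fun ρ w => s₁ ^ 2 • P ρ w + s₁ • Q ρ w + R ρ w)
          (W2SymOfK K N (fun κ u => s₁ ^ 2 • A κ u + s₁ • B κ u + C κ u) (fun ρ w => s₁ ^ 2 • P ρ w + s₁ • Q ρ w + R ρ w) T₁ M₂) μ y ν y' +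
      w₂ • K3OfK K N (fun κ u => s₂ ^ 2 • A κ u + s₂ • B κ u + C κ u) (fun ρ w => s₂ ^ 2 • P ρ w + s₂ • Q ρ w + R ρ w)
          (W2SymOfK K N (fun κ u => s₂ ^ 2 • A κ u + s₂ • B κ u + C κ u) (fun ρ w => s₂ ^ 2 • P ρ w + s₂ • Q ρ w + R ρ w) T₂ M₂) μ y ν y' +
      w₃ • K3OfK K N (fun κ u => s₃ ^ 2 • A κ u + s₃ • B κ u + C κ u) (fun ρ w => s₃ ^ 2 • P ρ w + s₃ • Q ρ w + R ρ w)
          (W2SymOfK K N (fun κ u => s₃ ^ 2 • A κ u + s₃ • B κ u + C κ u) (fun ρ w => s₃ ^ 2 • P ρ w + s₃ • Q ρ w + R ρ w) T₃ M₂) μ y ν y' +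
      w₄ • K3OfK K N (fun κ u => s₄ ^ 2 • A κ u + s₄ • B κ u + C κ u) (fun ρ w => s₄ ^ 2 • P ρ w + s₄ • Q ρ w + R ρ w)
          (W2SymOfK K N (fun κ u => s₄ ^ 2 • A κ u + s₄ • B κ u + C κ u) (fun ρ w => s₄ ^ 2 • P ρ w + s₄ • Q ρ w + R ρ w) T₄ M₂) μ y ν y' := by
  obtain ⟨δK, CK, hδK, -, hKd⟩ := id hK
  have hKs : Spr K := spr_of_decays hK
  obtain ⟨Bd, b₀, b₁, b₂, b₃, b₄⟩ := common_bound₂ hT₀ hT₁ hT₂ hT₃ hT₄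
  rw [K3OfK_source_decomp₃ hK hA hB hC hP hQ hR hM₂ Tt hTt t μ y ν y', K3OfK_source_decomp₃ hK hA hB hC hP hQ hR hM₂ T₀ hT₀ s₀ μ y ν y',
    K3OfK_source_decomp₃ hK hA hB hC hP hQ hR hM₂ T₁ hT₁ s₁ μ y ν y', K3OfK_source_decomp₃ hK hA hB hC hP hQ hR hM₂ T₂ hT₂ s₂ μ y ν y',
    K3OfK_source_decomp₃ hK hA hB hC hP hQ hR hM₂ T₃ hT₃ s₃ μ y ν y', K3OfK_source_decomp₃ hK hA hB hC hP hQ hR hM₂ T₄ hT₄ s₄ μ y ν y', hsum,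
    vsym_wsum5 hKd hδK N b₀ b₁ b₂ b₃ b₄ w₀ w₁ w₂ w₃ w₄ μ y ν y',
    sandwich_wsum5 hKs (loc_vsym hK T₀ hT₀ μ y ν y') (loc_vsym hK T₁ hT₁ μ y ν y') (loc_vsym hK T₂ hT₂ μ y ν y') (loc_vsym hK T₃ hT₃ μ y ν y') (loc_vsym hK T₄ hT₄ μ y ν y')]
  set X₄ := (comp (comp K (dM K N A P μ y)) (K2OfK K N A P ν y') +
            comp (comp K (dM K N A P ν y')) (K2OfK K N A P μ y)) with hX₄
  set X₃ := (comp (comp K (dM K N A P μ y)) (K2OfK K N B Q ν y') +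
            comp (comp K (dM K N A P ν y')) (K2OfK K N B Q μ y) +
            comp (comp K (dM K N B Q μ y)) (K2OfK K N A P ν y') +
            comp (comp K (dM K N B Q ν y')) (K2OfK K N A P μ y)) with hX₃
  set X₂ := (comp (comp K (dM K N A P μ y)) (K2OfK K N C R ν y') +
            comp (comp K (dM K N A P ν y')) (K2OfK K N C R μ y) +
            comp (comp K (dM K N B Q μ y)) (K2OfK K N B Q ν y') +
            comp (comp K (dM K N B Q ν y')) (K2OfK K N B Q μ y) +
            comp (comp K (dM K N C R μ y)) (K2OfK K N A P ν y') +
            comp (comp K (dM K N C R ν y')) (K2OfK K N A P μ y)) with hX₂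
  set X₁ := (comp (comp K (dM K N B Q μ y)) (K2OfK K N C R ν y') +
            comp (comp K (dM K N B Q ν y')) (K2OfK K N C R μ y) +
            comp (comp K (dM K N C R μ y)) (K2OfK K N B Q ν y') +
            comp (comp K (dM K N C R ν y')) (K2OfK K N B Q μ y)) with hX₁
  set X₀ := (comp (comp K (dM K N C R μ y)) (K2OfK K N C R ν y') +
            comp (comp K (dM K N C R ν y')) (K2OfK K N C R μ y)) with hX₀
  set E₄ := comp (comp K (dM (K2OfK K N A P ν y') N A P μ y +
            dM (K2OfK K N A P μ y) N A P ν y')) K with hE₄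
  set E₃ := comp (comp K (dM (K2OfK K N A P ν y') N B Q μ y +
            dM (K2OfK K N A P μ y) N B Q ν y' +
            dM (K2OfK K N B Q ν y') N A P μ y +
            dM (K2OfK K N B Q μ y) N A P ν y')) K with hE₃
  set E₂ := comp (comp K (dM (K2OfK K N A P ν y') N C R μ y +
            dM (K2OfK K N A P μ y) N C R ν y' +
            dM (K2OfK K N B Q ν y') N B Q μ y +
            dM (K2OfK K N B Q μ y) N B Q ν y' +
            dM (K2OfK K N C R ν y') N A P μ y +
            dM (K2OfK K N C R μ y) N A P ν y')) K with hE₂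
  set E₁ := comp (comp K (dM (K2OfK K N B Q ν y') N C R μ y +
            dM (K2OfK K N B Q μ y) N C R ν y' +
            dM (K2OfK K N C R ν y') N B Q μ y +
            dM (K2OfK K N C R μ y) N B Q ν y')) K with hE₁
  set E₀ := comp (comp K (dM (K2OfK K N C R ν y') N C R μ y +
            dM (K2OfK K N C R μ y) N C R ν y')) K with hE₀
  set W₀ := comp (comp K (W2SymOfK K N (fun (_ : Fin (d + 1)) (_ : Fin (d + 1) → ℤ) => (0 : MKer (d + 1) (Fib d))) (fun _ _ => 0) 0 M₂ μ y ν y')) K with hW₀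
  funext x z a b
  simp only [Pi.add_apply, Pi.sub_apply, Pi.neg_apply, Pi.smul_apply, smul_eq_mul]
  linear_combination (X₄ x z a b + E₄ x z a b / 2) * hm4 + (X₃ x z a b + E₃ x z a b / 2) * hm3 + (X₂ x z a b + E₂ x z a b / 2) * hm2 + (X₁ x z a b + E₁ x z a b / 2) * hm1 +
    (X₀ x z a b + E₀ x z a b / 2 + W₀ x z a b) * hm0

end OneLevel

/-! ## §3′ The tower along an affine line of colour triples: five-node form with all moments -/

section Tower

variable {Lc : ℕ} [NeZero Lc]

/-- [folklore] **an2's RECURSIVE BI-STENCIL FAMILY ALONG AN AFFINE LINE OF COLOUR TRIPLES IN THE FIVE-NODE FORM** (`1 ≤ Lc`, any `cE₂, cB, T`, certified border ∕ mixed tables, every level):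
for all nodes and weights with `Σ wᵢ sᵢ^k = t^k` (`k = 0,…,4`), `T2Of(c⃗₀ + t·c⃗₁) j = Σᵢ wᵢ • T2Of(c⃗₀ + sᵢ·c⃗₁) j`. -/
theorem T2Of_line_nodes (hLc : 1 ≤ Lc) (cE₀ cVH₀ cΛ₀ cE₁ cVH₁ cΛ₁ cE₂ cB : ℝ) (T : Fin 4 → Fin 4 → Fin 4 → Fin 4 → ℝ)
    {vh₂S : Fin (d + 1) → (Fin (d + 1) → ℤ) → Fin (d + 1) → (Fin (d + 1) → ℤ) → MKer (d + 1) (Fib d)} (hB : ∃ C δ : ℝ, 0 < δ ∧ LocStencil₂ vh₂S C δ)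
    {mixFF : Fin (d + 1) → (Fin (d + 1) → ℤ) → Fin (d + 1) → (Fin (d + 1) → ℤ) → MKer (d + 1) (Fib d)} (hmix : ∃ C δ : ℝ, 0 < δ ∧ LocStencilFM Lc mixFF C δ) :
    ∀ (j : ℕ) (t s₀ s₁ s₂ s₃ s₄ w₀ w₁ w₂ w₃ w₄ : ℝ), w₀ + w₁ + w₂ + w₃ + w₄ = 1 → w₀ * s₀ + w₁ * s₁ + w₂ * s₂ + w₃ * s₃ + w₄ * s₄ = t →
      w₀ * s₀ ^ 2 + w₁ * s₁ ^ 2 + w₂ * s₂ ^ 2 + w₃ * s₃ ^ 2 + w₄ * s₄ ^ 2 = t ^ 2 →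
      w₀ * s₀ ^ 3 + w₁ * s₁ ^ 3 + w₂ * s₂ ^ 3 + w₃ * s₃ ^ 3 + w₄ * s₄ ^ 3 = t ^ 3 → w₀ * s₀ ^ 4 + w₁ * s₁ ^ 4 + w₂ * s₂ ^ 4 + w₃ * s₃ ^ 4 + w₄ * s₄ ^ 4 = t ^ 4 →
      T2Of d Lc (cE₀ + t * cE₁) (cVH₀ + t * cVH₁) (cΛ₀ + t * cΛ₁) cE₂ cB T vh₂S mixFF j =
        w₀ • T2Of d Lc (cE₀ + s₀ * cE₁) (cVH₀ + s₀ * cVH₁) (cΛ₀ + s₀ * cΛ₁) cE₂ cB T vh₂S mixFF j + w₁ • T2Of d Lc (cE₀ + s₁ * cE₁) (cVH₀ + s₁ * cVH₁) (cΛ₀ + s₁ * cΛ₁) cE₂ cB T vh₂S mixFF j +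
          w₂ • T2Of d Lc (cE₀ + s₂ * cE₁) (cVH₀ + s₂ * cVH₁) (cΛ₀ + s₂ * cΛ₁) cE₂ cB T vh₂S mixFF j + w₃ • T2Of d Lc (cE₀ + s₃ * cE₁) (cVH₀ + s₃ * cVH₁) (cΛ₀ + s₃ * cΛ₁) cE₂ cB T vh₂S mixFF j +
          w₄ • T2Of d Lc (cE₀ + s₄ * cE₁) (cVH₀ + s₄ * cVH₁) (cΛ₀ + s₄ * cΛ₁) cE₂ cB T vh₂S mixFF j
  | 0, t, s₀, s₁, s₂, s₃, s₄, w₀, w₁, w₂, w₃, w₄, hm0, _, _, _, _ => by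
    simp only [T2Of_zero]
    rw [← add_smul, ← add_smul, ← add_smul, ← add_smul, hm0, one_smul]
  | j + 1, t, s₀, s₁, s₂, s₃, s₄, w₀, w₁, w₂, w₃, w₄, hm0, hm1, hm2, hm3, hm4 => by
    have IH := T2Of_line_nodes hLc cE₀ cVH₀ cΛ₀ cE₁ cVH₁ cΛ₁ cE₂ cB T hB hmix j t s₀ s₁ s₂ s₃ s₄ w₀ w₁ w₂ w₃ w₄ hm0 hm1 hm2 hm3 hm4
    obtain ⟨A, Bf, Cf, hA, hBf, hCf, hS⟩ := Spure_line (d := d) (Lc := Lc) hLc cE₀ cVH₀ cΛ₀ cE₁ cVH₁ cΛ₁ j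
    obtain ⟨P, Q, R, hP, hQ, hR, hM⟩ := M1_line (d := d) (Lc := Lc) hLc cΛ₀ cΛ₁ j
    have hK := decays_KInvStep (Lc := Lc) (d := d) j
    have hM₂ : ∃ C δ : ℝ, 0 < δ ∧ LocStencilFM Lc (M2Of d Lc mixFF j) C δ := by
      obtain ⟨C, δ, hδ, h⟩ := hmix; exact ⟨_, δ, hδ, locStencilFM_M2Of h j⟩
    have hTs : ∀ s : ℝ, ∃ C δ : ℝ, 0 < δ ∧ LocStencil₂ (T2Of d Lc (cE₀ + s * cE₁) (cVH₀ + s * cVH₁) (cΛ₀ + s * cΛ₁) cE₂ cB T vh₂S mixFF j) C δ :=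
      fun s => T2Of_loc hLc _ _ _ cE₂ cB T hB hmix j
    have key := K3OfK_line_nodes (N := Lc) hK hA hBf hCf hP hQ hR hM₂ (hTs s₀) (hTs s₁) (hTs s₂) (hTs s₃) (hTs s₄) (hTs t) t s₀ s₁ s₂ s₃ s₄ w₀ w₁ w₂ w₃ w₄ hm0 hm1 hm2 hm3 hm4 IH
    funext κ u κ' u'
    simp only [T2Of_succ, Pi.add_apply, Pi.smul_apply]
    unfold BalabanStepW2.WbalOf BalabanStepW2.e4OfW
    rw [hS t, hS s₀, hS s₁, hS s₂, hS s₃, hS s₄, hM t, hM s₀, hM s₁, hM s₂, hM s₃, hM s₄, key κ u κ' u', mmRead_add, mmRead_add, mmRead_add, mmRead_add, mmRead_smul, mmRead_smul,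
      mmRead_smul, mmRead_smul, mmRead_smul]
    funext x z a b
    simp only [Pi.add_apply, Pi.smul_apply, smul_eq_mul]
    linear_combination (-(cB * wB2 d Lc (j + 1) * StepJetData.mfNeg (vh₂S κ u κ' u') x z a b)) * hm0

/-- [folklore] **THE ASSEMBLED SECOND-ORDER FAMILY ALONG AN AFFINE LINE IN THE FIVE-NODE FORM** (same data, every level, every bond pair). -/
theorem WbalOf_line_nodes (hLc : 1 ≤ Lc) (cE₀ cVH₀ cΛ₀ cE₁ cVH₁ cΛ₁ cE₂ cB : ℝ) (T : Fin 4 → Fin 4 → Fin 4 → Fin 4 → ℝ)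
    {vh₂S : Fin (d + 1) → (Fin (d + 1) → ℤ) → Fin (d + 1) → (Fin (d + 1) → ℤ) → MKer (d + 1) (Fib d)} (hB : ∃ C δ : ℝ, 0 < δ ∧ LocStencil₂ vh₂S C δ)
    {mixFF : Fin (d + 1) → (Fin (d + 1) → ℤ) → Fin (d + 1) → (Fin (d + 1) → ℤ) → MKer (d + 1) (Fib d)} (hmix : ∃ C δ : ℝ, 0 < δ ∧ LocStencilFM Lc mixFF C δ)
    (j : ℕ) (t s₀ s₁ s₂ s₃ s₄ w₀ w₁ w₂ w₃ w₄ : ℝ) (hm0 : w₀ + w₁ + w₂ + w₃ + w₄ = 1) (hm1 : w₀ * s₀ + w₁ * s₁ + w₂ * s₂ + w₃ * s₃ + w₄ * s₄ = t)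
    (hm2 : w₀ * s₀ ^ 2 + w₁ * s₁ ^ 2 + w₂ * s₂ ^ 2 + w₃ * s₃ ^ 2 + w₄ * s₄ ^ 2 = t ^ 2)
    (hm3 : w₀ * s₀ ^ 3 + w₁ * s₁ ^ 3 + w₂ * s₂ ^ 3 + w₃ * s₃ ^ 3 + w₄ * s₄ ^ 3 = t ^ 3) (hm4 : w₀ * s₀ ^ 4 + w₁ * s₁ ^ 4 + w₂ * s₂ ^ 4 + w₃ * s₃ ^ 4 + w₄ * s₄ ^ 4 = t ^ 4)
    (μ : Fin (d + 1)) (y : Fin (d + 1) → ℤ) (ν : Fin (d + 1)) (y' : Fin (d + 1) → ℤ) :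
    WbalOf d Lc (cE₀ + t * cE₁) (cVH₀ + t * cVH₁) (cΛ₀ + t * cΛ₁) (T2Of d Lc (cE₀ + t * cE₁) (cVH₀ + t * cVH₁) (cΛ₀ + t * cΛ₁) cE₂ cB T vh₂S mixFF) mixFF j μ y ν y' =
      w₀ • WbalOf d Lc (cE₀ + s₀ * cE₁) (cVH₀ + s₀ * cVH₁) (cΛ₀ + s₀ * cΛ₁) (T2Of d Lc (cE₀ + s₀ * cE₁) (cVH₀ + s₀ * cVH₁) (cΛ₀ + s₀ * cΛ₁) cE₂ cB T vh₂S mixFF) mixFF j μ y ν y' +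
      w₁ • WbalOf d Lc (cE₀ + s₁ * cE₁) (cVH₀ + s₁ * cVH₁) (cΛ₀ + s₁ * cΛ₁) (T2Of d Lc (cE₀ + s₁ * cE₁) (cVH₀ + s₁ * cVH₁) (cΛ₀ + s₁ * cΛ₁) cE₂ cB T vh₂S mixFF) mixFF j μ y ν y' +
      w₂ • WbalOf d Lc (cE₀ + s₂ * cE₁) (cVH₀ + s₂ * cVH₁) (cΛ₀ + s₂ * cΛ₁) (T2Of d Lc (cE₀ + s₂ * cE₁) (cVH₀ + s₂ * cVH₁) (cΛ₀ + s₂ * cΛ₁) cE₂ cB T vh₂S mixFF) mixFF j μ y ν y' +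
      w₃ • WbalOf d Lc (cE₀ + s₃ * cE₁) (cVH₀ + s₃ * cVH₁) (cΛ₀ + s₃ * cΛ₁) (T2Of d Lc (cE₀ + s₃ * cE₁) (cVH₀ + s₃ * cVH₁) (cΛ₀ + s₃ * cΛ₁) cE₂ cB T vh₂S mixFF) mixFF j μ y ν y' +
      w₄ • WbalOf d Lc (cE₀ + s₄ * cE₁) (cVH₀ + s₄ * cVH₁) (cΛ₀ + s₄ * cΛ₁) (T2Of d Lc (cE₀ + s₄ * cE₁) (cVH₀ + s₄ * cVH₁) (cΛ₀ + s₄ * cΛ₁) cE₂ cB T vh₂S mixFF) mixFF j μ y ν y' := by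
  have IH := T2Of_line_nodes hLc cE₀ cVH₀ cΛ₀ cE₁ cVH₁ cΛ₁ cE₂ cB T hB hmix j t s₀ s₁ s₂ s₃ s₄ w₀ w₁ w₂ w₃ w₄ hm0 hm1 hm2 hm3 hm4
  obtain ⟨A, Bf, Cf, hA, hBf, hCf, hS⟩ := Spure_line (d := d) (Lc := Lc) hLc cE₀ cVH₀ cΛ₀ cE₁ cVH₁ cΛ₁ j
  obtain ⟨P, Q, R, hP, hQ, hR, hM⟩ := M1_line (d := d) (Lc := Lc) hLc cΛ₀ cΛ₁ j
  have hK := decays_KInvStep (Lc := Lc) (d := d) j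
  obtain ⟨δK, CK, hδK, -, hKd⟩ := id hK
  obtain ⟨Bd, b₀, b₁, b₂, b₃, b₄⟩ := common_bound₂ (T2Of_loc hLc (cE₀ + s₀ * cE₁) (cVH₀ + s₀ * cVH₁) (cΛ₀ + s₀ * cΛ₁) cE₂ cB T hB hmix j)
    (T2Of_loc hLc (cE₀ + s₁ * cE₁) (cVH₀ + s₁ * cVH₁) (cΛ₀ + s₁ * cΛ₁) cE₂ cB T hB hmix j) (T2Of_loc hLc (cE₀ + s₂ * cE₁) (cVH₀ + s₂ * cVH₁) (cΛ₀ + s₂ * cΛ₁) cE₂ cB T hB hmix j)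
    (T2Of_loc hLc (cE₀ + s₃ * cE₁) (cVH₀ + s₃ * cVH₁) (cΛ₀ + s₃ * cΛ₁) cE₂ cB T hB hmix j) (T2Of_loc hLc (cE₀ + s₄ * cE₁) (cVH₀ + s₄ * cVH₁) (cΛ₀ + s₄ * cΛ₁) cE₂ cB T hB hmix j)
  have ev : ∀ (Sx : Fin (d + 1) → (Fin (d + 1) → ℤ) → MKer (d + 1) (Fib d)) (Mx : Fin (d + 1) → (Fin (d + 1) → ℤ) → MKer (d + 1) (Fib d))
      (S₂ : Fin (d + 1) → (Fin (d + 1) → ℤ) → Fin (d + 1) → (Fin (d + 1) → ℤ) → MKer (d + 1) (Fib d)),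
      W2SymOfK (KInvStep (d := d) Lc j) Lc Sx Mx S₂ (M2Of d Lc mixFF j) μ y ν y' =
        W2SymOfK (KInvStep (d := d) Lc j) Lc Sx Mx 0 (M2Of d Lc mixFF j) μ y ν y' + vsym (KInvStep (d := d) Lc j) Lc S₂ μ y ν y' := fun Sx Mx S₂ => by
    have e := congrArg (fun F => F μ y ν y') (W2SymOfK_eq_add_vsym (KInvStep (d := d) Lc j) Lc Sx Mx S₂ (M2Of d Lc mixFF j))
    simpa only [Pi.add_apply] using e
  unfold BalabanStepW2.WbalOf
  rw [hS t, hS s₀, hS s₁, hS s₂, hS s₃, hS s₄, hM t, hM s₀, hM s₁, hM s₂, hM s₃, hM s₄]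
  rw [ev _ _ (T2Of d Lc _ _ _ cE₂ cB T vh₂S mixFF j), ev (fun κ u => s₀ ^ 2 • A κ u + s₀ • Bf κ u + Cf κ u), ev (fun κ u => s₁ ^ 2 • A κ u + s₁ • Bf κ u + Cf κ u),
    ev (fun κ u => s₂ ^ 2 • A κ u + s₂ • Bf κ u + Cf κ u), ev (fun κ u => s₃ ^ 2 • A κ u + s₃ • Bf κ u + Cf κ u), ev (fun κ u => s₄ ^ 2 • A κ u + s₄ • Bf κ u + Cf κ u),
    W2SymOfK_path₃ hK hA hBf hCf hP hQ hR _ _ t μ y ν y', W2SymOfK_path₃ hK hA hBf hCf hP hQ hR _ _ s₀ μ y ν y', W2SymOfK_path₃ hK hA hBf hCf hP hQ hR _ _ s₁ μ y ν y',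
    W2SymOfK_path₃ hK hA hBf hCf hP hQ hR _ _ s₂ μ y ν y', W2SymOfK_path₃ hK hA hBf hCf hP hQ hR _ _ s₃ μ y ν y', W2SymOfK_path₃ hK hA hBf hCf hP hQ hR _ _ s₄ μ y ν y', IH,
    vsym_wsum5 hKd hδK Lc b₀ b₁ b₂ b₃ b₄ w₀ w₁ w₂ w₃ w₄ μ y ν y']
  set K' := KInvStep (d := d) Lc j with hK'
  set E₄ := dM (K2OfK K' Lc A P ν y') Lc A P μ y + dM (K2OfK K' Lc A P μ y) Lc A P ν y' with hE₄
  set E₃ := dM (K2OfK K' Lc A P ν y') Lc Bf Q μ y + dM (K2OfK K' Lc A P μ y) Lc Bf Q ν y' + dM (K2OfK K' Lc Bf Q ν y') Lc A P μ y +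
    dM (K2OfK K' Lc Bf Q μ y) Lc A P ν y' with hE₃
  set E₂ := dM (K2OfK K' Lc A P ν y') Lc Cf R μ y + dM (K2OfK K' Lc A P μ y) Lc Cf R ν y' + dM (K2OfK K' Lc Bf Q ν y') Lc Bf Q μ y +
    dM (K2OfK K' Lc Bf Q μ y) Lc Bf Q ν y' + dM (K2OfK K' Lc Cf R ν y') Lc A P μ y + dM (K2OfK K' Lc Cf R μ y) Lc A P ν y' with hE₂
  set E₁ := dM (K2OfK K' Lc Bf Q ν y') Lc Cf R μ y + dM (K2OfK K' Lc Bf Q μ y) Lc Cf R ν y' + dM (K2OfK K' Lc Cf R ν y') Lc Bf Q μ y +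
    dM (K2OfK K' Lc Cf R μ y) Lc Bf Q ν y' with hE₁
  set E₀ := dM (K2OfK K' Lc Cf R ν y') Lc Cf R μ y + dM (K2OfK K' Lc Cf R μ y) Lc Cf R ν y' with hE₀
  set W₀ := W2SymOfK K' Lc (fun (_ : Fin (d + 1)) (_ : Fin (d + 1) → ℤ) => (0 : MKer (d + 1) (Fib d))) (fun _ _ => 0) 0 (M2Of d Lc mixFF j) μ y ν y' with hW₀
  funext x z a b
  simp only [Pi.add_apply, Pi.smul_apply, smul_eq_mul]
  linear_combination (-(E₄ x z a b) / 2) * hm4 + (-(E₃ x z a b) / 2) * hm3 + (-(E₂ x z a b) / 2) * hm2 + (-(E₁ x z a b) / 2) * hm1 -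
    (W₀ x z a b + E₀ x z a b / 2) * hm0

end Tower

end Summit.QuantumFields.BalabanUV.Gaps.D1PinnedColourLineQuartic

end
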